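import Literature.NumberTheory.Sieve.SmoothArcClasses
import Mathlib.NumberTheory.DirichletCharacter.Bounds
import HarnessLib

/-!
# Smooth-weighted exponential sums over a residue class at `h/k + λ/X`: the estimate

Topic `Literature/NumberTheory/Sieve`; a PROVED file, the class-restricted companion of
`SmoothArcPrincipal.principalPart_estimate` / `SmoothEndgameArcs.principalPart_estimate_scaled`
([Harper2016, §2.2, §5], [MontgomeryVaughanActa1975, §5–6]). With the notation of `SmoothArcClasses`
(`L = lcm(k, m)`, `g_t = (t, L)`, `L'_t = L/g_t`, `X = x/e`, `α = α(x, y)`,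
`𝓜 = x^α ζ(α,y)/√(2πφ₂(α,y))`), steps (3)–(5) of the argument:

* `principal_fiber_bound` (step 3): `φ(L')⁻¹ U(X/g, L') = φ(L')⁻¹ ∑_{d ∣ L'} μ(d) S_w(λ; X/(gd))`
  (`coprimeTwistSum_eq_sum_moebius`), and if every `S_w(λ; X/(gd))` is `(gd)^{−α} A Ŵ` up to
  `(gd)^{−α} E` then, by `∑_{d ∣ L'} μ(d) d^{−α} = ∏_{p ∣ L'} (1 − p^{−α})` (`sum_divisors_moebius_rpow`),
  `φ(L')⁻¹ U(X/g, L')` is `g^{−α} ∏_{p ∣ L'}(1 − p^{−α})/φ(L') · A Ŵ` up to `g^{−α} τ(L')/φ(L') · E`;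
* `nonprincipal_fiber_bound`, `charSum_bound_subscale` (step 4): the `φ(L') − 1` non-principal
  characters contribute at most the sup of their sums, and a bound
  `C (1+|λ|)³ X^{1/2+ε₀} q^{ε₀}` for `X ≥ 1` descends to the sub-scales `X/g` (empty sum if `X/g < 1`);
* `fiber_estimate`, `classArcSum_estimate` (step 5): summing over the `≤ L` classes `t`,

  `‖classArcSum (x/e) − classLocalFactor · e^{−α}𝓜 Ŵ_λ(α)‖ ≤ e^{−α} ε𝓜/(1+|λ|) · classLocalH`
  `+ L · C_F (1+|λ|)³ (x/e)^{1/2+ε₀} L^{ε₀}`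

  for `x ≥ x₀`, `(log x)^4 ≤ y ≤ exp((log x)^{1/5})`, `Λ⁸ ≤ y`, `|λ| ≤ Λ`, `e, k, m ≤ (log x)^B`,
  `k, m ∈ S(y)`, `(r, m) = 1`, ANY `h ∈ ℤ`, given (hW) the saddle-point evaluation of
  `S_w(λ; x/e')` uniformly in `e' ≤ (log x)^{B'}` and (hF) a GRH-type bound for the smooth-weighted
  sums of non-principal characters. Both inputs are hypotheses of the theorem (the tree proves (hW)
  with `B' = 100` in `SmoothTwistedSaddleRange.scaledSum_main_term`).

## References

* A. J. Harper, Compositio Math. 152 (2016), §2.2, §5 [Harper2016].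
* H. L. Montgomery, R. C. Vaughan, Acta Arith. 27 (1975), §5–6 [MontgomeryVaughanActa1975].
-/

noncomputable section

open Finset Real Complex
open scoped ArithmeticFunction.Moebius FourierTransform

namespace Literature.NumberTheory.Sieve

namespace SmoothArcs

open MontgomeryVaughan1975 TwistedWeight

/-! ### Step 3: the principal part of one fibre -/

/-- **Principal part of a fibre.** For `g ≥ 1`, `L' ≥ 1` `y`-friable, `α ≥ 0`: if
`‖S_w(λ; X/(gd)) − (gd)^{−α} A W‖ ≤ (gd)^{−α} E` for all `d ∣ L'`, then
`‖φ(L')⁻¹ U(X/g, L') − g^{−α} ∏_{p∣L'}(1−p^{−α})/φ(L') · A W‖ ≤ g^{−α} τ(L')/φ(L') · E`.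
[cite: Harper2016, §2.2 (Major Arc Estimate 2) and §5] -/
theorem principal_fiber_bound {X : ℝ} (hX : 0 ≤ X) {y g L' : ℕ} (hg : 0 < g) (hL' : L' ≠ 0)
    (hL'S : L' ∈ Nat.smoothNumbers (y + 1)) {α : ℝ} (hα : 0 ≤ α) (A E : ℝ) (W : ℂ) (lam : ℝ)
    (hS : ∀ d ∈ L'.divisors, ‖smoothTwistSum (X / g / d) y lam - ((((g * d : ℕ) : ℝ) ^ (-α) * A : ℝ) : ℂ) * W‖ ≤
      ((g * d : ℕ) : ℝ) ^ (-α) * E) :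
    ‖((L'.totient : ℂ))⁻¹ * coprimeTwistSum (X / g) y L' lam -
        (((g : ℝ) ^ (-α) * (∏ p ∈ L'.primeFactors, (1 - (p : ℝ) ^ (-α))) / (L'.totient : ℝ) * A : ℝ) : ℂ) * W‖ ≤
      (g : ℝ) ^ (-α) * (L'.divisors.card : ℝ) / (L'.totient : ℝ) * E := by
  have hXg : 0 ≤ X / g := by positivity
  -- `U` as a Möbius sum (all divisors of `L'` are friable)
  have hU : coprimeTwistSum (X / g) y L' lam = ∑ d ∈ L'.divisors, (μ d : ℂ) * smoothTwistSum (X / g / d) y lam := by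
    rw [coprimeTwistSum_eq_sum_moebius hXg y hL' lam]
    refine Finset.sum_congr rfl fun d hd => ?_
    rw [if_pos (mem_smoothNumbers_of_mem_divisors hL'S hd)]
  -- the main term as the same Möbius sum
  have hmain : (((g : ℝ) ^ (-α) * (∏ p ∈ L'.primeFactors, (1 - (p : ℝ) ^ (-α))) / (L'.totient : ℝ) * A : ℝ) : ℂ) * W =
      ((L'.totient : ℂ))⁻¹ * ∑ d ∈ L'.divisors, (μ d : ℂ) * ((((((g * d : ℕ) : ℝ) ^ (-α) * A : ℝ)) : ℂ) * W) := by
    rw [← sum_divisors_moebius_rpow hL' α, Finset.mul_sum, Finset.sum_div, Finset.sum_mul, Complex.ofReal_sum,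
      Finset.sum_mul, Finset.mul_sum]
    refine Finset.sum_congr rfl fun d _ => ?_
    have hgd : ((g * d : ℕ) : ℝ) ^ (-α) = (g : ℝ) ^ (-α) * (d : ℝ) ^ (-α) := by
      push_cast; exact Real.mul_rpow (Nat.cast_nonneg g) (Nat.cast_nonneg d)
    rw [hgd]
    push_cast
    rw [div_eq_mul_inv]
    ring
  have hdiff : ((L'.totient : ℂ))⁻¹ * coprimeTwistSum (X / g) y L' lam -
      (((g : ℝ) ^ (-α) * (∏ p ∈ L'.primeFactors, (1 - (p : ℝ) ^ (-α))) / (L'.totient : ℝ) * A : ℝ) : ℂ) * W =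
      ((L'.totient : ℂ))⁻¹ * ∑ d ∈ L'.divisors, (μ d : ℂ) *
        (smoothTwistSum (X / g / d) y lam - (((((g * d : ℕ) : ℝ) ^ (-α) * A : ℝ)) : ℂ) * W) := by
    rw [hmain, hU, ← mul_sub, ← Finset.sum_sub_distrib]
    congr 1
    refine Finset.sum_congr rfl fun d _ => by ring
  rw [hdiff, norm_mul, norm_inv, Complex.norm_natCast]
  -- `E ≥ 0` (from the hypothesis at `d = 1`) and `d^{-α} ≤ 1`
  have h1mem : 1 ∈ L'.divisors := Nat.one_mem_divisors.mpr hL'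
  have hE : 0 ≤ E := by
    have h := (norm_nonneg _).trans (hS 1 h1mem)
    have hpos : 0 < ((g * 1 : ℕ) : ℝ) ^ (-α) := Real.rpow_pos_of_pos (by rw [mul_one]; exact_mod_cast hg) _
    exact nonneg_of_mul_nonneg_right h hpos
  have hgα : 0 ≤ (g : ℝ) ^ (-α) := Real.rpow_nonneg (Nat.cast_nonneg g) _
  have hterm : ∀ d ∈ L'.divisors, ‖(μ d : ℂ) *
      (smoothTwistSum (X / g / d) y lam - (((((g * d : ℕ) : ℝ) ^ (-α) * A : ℝ)) : ℂ) * W)‖ ≤ (g : ℝ) ^ (-α) * E := by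
    intro d hd
    have hd1 : 1 ≤ d := Nat.pos_of_mem_divisors hd
    rw [norm_mul]
    have hμ : ‖(μ d : ℂ)‖ ≤ 1 := by
      rw [Complex.norm_intCast]; exact_mod_cast ArithmeticFunction.abs_moebius_le_one
    have hgd : ((g * d : ℕ) : ℝ) ^ (-α) ≤ (g : ℝ) ^ (-α) := by
      push_cast
      rw [Real.mul_rpow (Nat.cast_nonneg g) (Nat.cast_nonneg d)]
      have hd' : (d : ℝ) ^ (-α) ≤ 1 := Real.rpow_le_one_of_one_le_of_nonpos (by exact_mod_cast hd1) (by linarith)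
      calc (g : ℝ) ^ (-α) * (d : ℝ) ^ (-α) ≤ (g : ℝ) ^ (-α) * 1 := mul_le_mul_of_nonneg_left hd' hgα
        _ = _ := mul_one _
    calc ‖(μ d : ℂ)‖ * ‖smoothTwistSum (X / g / d) y lam - (((((g * d : ℕ) : ℝ) ^ (-α) * A : ℝ)) : ℂ) * W‖
        ≤ 1 * (((g * d : ℕ) : ℝ) ^ (-α) * E) := mul_le_mul hμ (hS d hd) (norm_nonneg _) zero_le_one
      _ ≤ (g : ℝ) ^ (-α) * E := by rw [one_mul]; exact mul_le_mul_of_nonneg_right hgd hE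
  have hφpos : (0 : ℝ) < (L'.totient : ℝ) := by exact_mod_cast Nat.totient_pos.mpr (Nat.pos_of_ne_zero hL')
  calc (L'.totient : ℝ)⁻¹ * ‖∑ d ∈ L'.divisors, (μ d : ℂ) *
        (smoothTwistSum (X / g / d) y lam - (((((g * d : ℕ) : ℝ) ^ (-α) * A : ℝ)) : ℂ) * W)‖
      ≤ (L'.totient : ℝ)⁻¹ * ∑ d ∈ L'.divisors, (g : ℝ) ^ (-α) * E :=
        mul_le_mul_of_nonneg_left ((norm_sum_le _ _).trans (Finset.sum_le_sum hterm)) (by positivity)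
    _ = (g : ℝ) ^ (-α) * (L'.divisors.card : ℝ) / (L'.totient : ℝ) * E := by
        rw [Finset.sum_const, nsmul_eq_mul, div_eq_mul_inv]
        ring

/-! ### Step 4: the non-principal characters of one fibre -/

/-- **Non-principal part of a fibre.** If every non-principal `ψ (mod L')` has
`‖∑_{n ∈ S(X,y)} ψ(n) W_λ(n/X)‖ ≤ B`, then `‖φ(L')⁻¹ ∑_{ψ ≠ ψ₀} ψ(a) ∑_n ψ(n) W_λ(n/X)‖ ≤ B`.
[cite: MontgomeryVaughanActa1975, §6 (6.1)] -/
theorem nonprincipal_fiber_bound (X : ℝ) (y : ℕ) {L' : ℕ} [NeZero L'] (a : ZMod L') (lam : ℝ) {Bd : ℝ}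
    (hBd : 0 ≤ Bd)
    (hF : ∀ ψ : DirichletCharacter ℂ L', ψ ≠ 1 →
      ‖∑ n ∈ Nat.smoothNumbersUpTo ⌊X⌋₊ (y + 1), ψ (n : ZMod L') * twistWeight lam (n / X)‖ ≤ Bd) :
    ‖((L'.totient : ℂ))⁻¹ * ∑ ψ ∈ (Finset.univ : Finset (DirichletCharacter ℂ L')).erase 1,
        ψ a * ∑ n ∈ Nat.smoothNumbersUpTo ⌊X⌋₊ (y + 1), ψ (n : ZMod L') * twistWeight lam (n / X)‖ ≤ Bd := by
  have hφpos : (0 : ℝ) < (L'.totient : ℝ) := by exact_mod_cast Nat.totient_pos.mpr (NeZero.pos L')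
  have hterm : ∀ ψ ∈ (Finset.univ : Finset (DirichletCharacter ℂ L')).erase 1,
      ‖ψ a * ∑ n ∈ Nat.smoothNumbersUpTo ⌊X⌋₊ (y + 1), ψ (n : ZMod L') * twistWeight lam (n / X)‖ ≤ Bd := by
    intro ψ hψ
    have hψ1 : ψ ≠ 1 := Finset.ne_of_mem_erase hψ
    rw [norm_mul]
    calc ‖ψ a‖ * ‖∑ n ∈ Nat.smoothNumbersUpTo ⌊X⌋₊ (y + 1), ψ (n : ZMod L') * twistWeight lam (n / X)‖ ≤ 1 * Bd :=
          mul_le_mul (DirichletCharacter.norm_le_one ψ a) (hF ψ hψ1) (norm_nonneg _) zero_le_one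
      _ = Bd := one_mul Bd
  rw [norm_mul, norm_inv, Complex.norm_natCast]
  calc (L'.totient : ℝ)⁻¹ * ‖∑ ψ ∈ (Finset.univ : Finset (DirichletCharacter ℂ L')).erase 1,
        ψ a * ∑ n ∈ Nat.smoothNumbersUpTo ⌊X⌋₊ (y + 1), ψ (n : ZMod L') * twistWeight lam (n / X)‖
      ≤ (L'.totient : ℝ)⁻¹ * ∑ ψ ∈ (Finset.univ : Finset (DirichletCharacter ℂ L')).erase 1, Bd :=
        mul_le_mul_of_nonneg_left ((norm_sum_le _ _).trans (Finset.sum_le_sum hterm)) (by positivity)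
    _ ≤ (L'.totient : ℝ)⁻¹ * ∑ _ψ ∈ (Finset.univ : Finset (DirichletCharacter ℂ L')), Bd := by
        apply mul_le_mul_of_nonneg_left _ (by positivity)
        exact Finset.sum_le_sum_of_subset_of_nonneg (Finset.erase_subset _ _) fun _ _ _ => hBd
    _ = Bd := by
        rw [Finset.sum_const, nsmul_eq_mul, Finset.card_univ, ← Nat.card_eq_fintype_card,
          DirichletCharacter.card_eq_totient_of_hasEnoughRootsOfUnity ℂ L']
        field_simp

/-- **The character-sum currency on a sub-scale.** If
`‖∑_{n ∈ S(X,y)} χ(n) W_λ(n/X)‖ ≤ C (1+|λ|)³ X^{1/2+ε₀} q^{ε₀}` for all `q ≥ 1`, `χ ≠ χ₀ (mod q)`, `X ≥ 1`,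
then for `X ≥ 0`, `g ≥ 1`, `1 ≤ L' ≤ L` and `ψ ≠ ψ₀ (mod L')`:
`‖∑_{n ∈ S(X/g,y)} ψ(n) W_λ(n/(X/g))‖ ≤ C (1+|λ|)³ X^{1/2+ε₀} L^{ε₀}` (the sum is empty if `X/g < 1`).
[folklore] -/
theorem charSum_bound_subscale {C ε₀ : ℝ} (hC : 0 < C) (hε₀ : 0 < ε₀)
    (hF : ∀ (q : ℕ) (χ : DirichletCharacter ℂ q), q ≠ 0 → χ ≠ 1 → ∀ (y : ℕ) (X lam : ℝ), 1 ≤ X →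
      ‖∑ n ∈ Nat.smoothNumbersUpTo ⌊X⌋₊ (y + 1), χ (n : ZMod q) * twistWeight lam (n / X)‖ ≤
        C * (1 + |lam|) ^ 3 * X ^ (1 / 2 + ε₀) * (q : ℝ) ^ ε₀)
    {X : ℝ} (hX : 0 ≤ X) {g L L' : ℕ} (hg : 0 < g) (hL' : L' ≠ 0) (hL'L : L' ≤ L) (y : ℕ) (lam : ℝ)
    (ψ : DirichletCharacter ℂ L') (hψ : ψ ≠ 1) :
    ‖∑ n ∈ Nat.smoothNumbersUpTo ⌊X / g⌋₊ (y + 1), ψ (n : ZMod L') * twistWeight lam (n / (X / g))‖ ≤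
      C * (1 + |lam|) ^ 3 * X ^ (1 / 2 + ε₀) * (L : ℝ) ^ ε₀ := by
  have hXg : 0 ≤ X / g := by positivity
  have hXgX : X / g ≤ X := div_le_self hX (by exact_mod_cast hg)
  have h3 : 0 ≤ (X / g) ^ (1 / 2 + ε₀) := Real.rpow_nonneg hXg _
  have h4 : 0 ≤ (L' : ℝ) ^ ε₀ := Real.rpow_nonneg (Nat.cast_nonneg L') _
  have hmono : C * (1 + |lam|) ^ 3 * (X / g) ^ (1 / 2 + ε₀) * (L' : ℝ) ^ ε₀ ≤
      C * (1 + |lam|) ^ 3 * X ^ (1 / 2 + ε₀) * (L : ℝ) ^ ε₀ := by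
    have h1 : (X / g) ^ (1 / 2 + ε₀) ≤ X ^ (1 / 2 + ε₀) := Real.rpow_le_rpow hXg hXgX (by linarith)
    have h2 : (L' : ℝ) ^ ε₀ ≤ (L : ℝ) ^ ε₀ := Real.rpow_le_rpow (Nat.cast_nonneg L') (by exact_mod_cast hL'L) hε₀.le
    have h5 : 0 ≤ C * (1 + |lam|) ^ 3 := by positivity
    calc C * (1 + |lam|) ^ 3 * (X / g) ^ (1 / 2 + ε₀) * (L' : ℝ) ^ ε₀
        ≤ C * (1 + |lam|) ^ 3 * X ^ (1 / 2 + ε₀) * (L' : ℝ) ^ ε₀ :=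
          mul_le_mul_of_nonneg_right (mul_le_mul_of_nonneg_left h1 h5) h4
      _ ≤ C * (1 + |lam|) ^ 3 * X ^ (1 / 2 + ε₀) * (L : ℝ) ^ ε₀ :=
          mul_le_mul_of_nonneg_left h2 (by positivity)
  by_cases h1 : 1 ≤ X / g
  · exact (hF L' ψ hL' hψ y (X / g) lam h1).trans hmono
  · have hempty : ∀ n ∈ Nat.smoothNumbersUpTo ⌊X / g⌋₊ (y + 1),
        ψ (n : ZMod L') * twistWeight lam (n / (X / g)) = 0 := by
      intro n hn
      exfalso
      rw [Nat.mem_smoothNumbersUpTo] at hn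
      have hfl : ⌊X / g⌋₊ = 0 := Nat.floor_eq_zero.mpr (lt_of_not_ge h1)
      have hn0 : n = 0 := Nat.le_zero.mp (hfl ▸ hn.1)
      exact Nat.ne_zero_of_mem_smoothNumbers hn.2 hn0
    rw [Finset.sum_eq_zero hempty, norm_zero]
    exact le_trans (by positivity) hmono

/-! ### Step 5: one fibre, and the sum over the classes -/

/-- **One fibre.** For `t < L`, `L ∈ S(y)`, `g = (t, L)`, `L' = L/g`, `α ≥ 0`: if
`‖S_w(λ; X/e') − e'^{−α} A W‖ ≤ e'^{−α} E` for every `e' ∣ L` and every non-principal character sum on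
every sub-scale `X/g'` (`g' ≥ 1`) to every modulus `L'' ≤ L` is at most `B ≥ 0`, then
`‖∑_{n ∈ S(X,y), n % L = t} W_λ(n/X) − g^{−α} ∏_{p∣L'}(1−p^{−α})/φ(L') · A W‖ ≤ g^{−α} τ(L')/φ(L') · E + B`.
[cite: Harper2016, §2.2, §5] -/
theorem fiber_estimate {X : ℝ} (hX : 0 ≤ X) {y L t : ℕ} (hL : L ≠ 0) (ht : t < L)
    (hLS : L ∈ Nat.smoothNumbers (y + 1)) {α : ℝ} (hα : 0 ≤ α) (A E : ℝ) (W : ℂ) (lam : ℝ) {Bd : ℝ}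
    (hBd : 0 ≤ Bd)
    (hS : ∀ e' : ℕ, e' ∣ L →
      ‖smoothTwistSum (X / e') y lam - ((((e' : ℕ) : ℝ) ^ (-α) * A : ℝ) : ℂ) * W‖ ≤ (e' : ℝ) ^ (-α) * E)
    (hF : ∀ (g' L'' : ℕ) [NeZero L''], 0 < g' → L'' ≤ L → ∀ ψ : DirichletCharacter ℂ L'', ψ ≠ 1 →
      ‖∑ n ∈ Nat.smoothNumbersUpTo ⌊X / g'⌋₊ (y + 1), ψ (n : ZMod L'') * twistWeight lam (n / (X / g'))‖ ≤ Bd) :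
    ‖(∑ n ∈ (Nat.smoothNumbersUpTo ⌊X⌋₊ (y + 1)).filter (fun n => n % L = t), twistWeight lam (n / X)) -
        ((((Nat.gcd t L : ℕ) : ℝ) ^ (-α) * (∏ p ∈ (L / Nat.gcd t L).primeFactors, (1 - (p : ℝ) ^ (-α))) /
          ((L / Nat.gcd t L).totient : ℝ) * A : ℝ) : ℂ) * W‖ ≤
      ((Nat.gcd t L : ℕ) : ℝ) ^ (-α) * ((L / Nat.gcd t L).divisors.card : ℝ) / ((L / Nat.gcd t L).totient : ℝ) * E +
        Bd := by
  rw [sum_filter_mod_eq hX hL ht hLS lam]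
  set g : ℕ := Nat.gcd t L with hg
  set L' : ℕ := L / g with hL'
  set t' : ℕ := t / g with ht'
  have hg0 : 0 < g := Nat.gcd_pos_of_pos_right t (Nat.pos_of_ne_zero hL)
  have hgL : g ∣ L := Nat.gcd_dvd_right t L
  have hL'0 : L' ≠ 0 := (Nat.div_ne_zero_iff_of_dvd hgL).mpr ⟨hL, hg0.ne'⟩
  haveI : NeZero L' := ⟨hL'0⟩
  have hL'L : L' ≤ L := Nat.div_le_self L g
  have hL'S : L' ∈ Nat.smoothNumbers (y + 1) := Nat.mem_smoothNumbers_of_dvd hLS (Nat.div_dvd_of_dvd hgL)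
  have hcop : t'.Coprime L' := Nat.coprime_div_gcd_div_gcd hg0
  rw [classFiber_eq (X / g) y hcop lam]
  have hS' : ∀ d ∈ L'.divisors, ‖smoothTwistSum (X / g / d) y lam - ((((g * d : ℕ) : ℝ) ^ (-α) * A : ℝ) : ℂ) * W‖ ≤
      ((g * d : ℕ) : ℝ) ^ (-α) * E := by
    intro d hd
    have hgd : g * d ∣ L := Nat.mul_dvd_of_dvd_div hgL (Nat.dvd_of_mem_divisors hd)
    have h := hS (g * d) hgd
    have hsc : X / ((g * d : ℕ) : ℝ) = X / g / d := by push_cast; rw [div_div]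
    rwa [hsc] at h
  have hP := principal_fiber_bound hX hg0 hL'0 hL'S hα A E W lam hS'
  have hN := nonprincipal_fiber_bound (X / g) y ((t' : ZMod L')⁻¹) lam hBd (fun ψ hψ => hF g L' hg0 hL'L ψ hψ)
  set P : ℂ := ((L'.totient : ℂ))⁻¹ * coprimeTwistSum (X / g) y L' lam with hPdef
  set N : ℂ := ((L'.totient : ℂ))⁻¹ * ∑ ψ ∈ (Finset.univ : Finset (DirichletCharacter ℂ L')).erase 1,
      ψ ((t' : ZMod L')⁻¹) * ∑ n ∈ Nat.smoothNumbersUpTo ⌊X / g⌋₊ (y + 1), ψ (n : ZMod L') * twistWeight lam (n / (X / g))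
    with hNdef
  set main : ℂ := (((g : ℝ) ^ (-α) * (∏ p ∈ L'.primeFactors, (1 - (p : ℝ) ^ (-α))) / (L'.totient : ℝ) * A : ℝ) : ℂ) * W
    with hmain
  calc ‖P + N - main‖ = ‖(P - main) + N‖ := by ring_nf
    _ ≤ ‖P - main‖ + ‖N‖ := norm_add_le _ _
    _ ≤ _ := add_le_add hP hN

/-- `α(x, y) ≥ 0` (it is positive for `x > 1`, `y ≥ 2`, and the junk value `0` otherwise). [folklore] -/
theorem saddlePoint_nonneg (x : ℝ) (y : ℕ) : 0 ≤ saddlePoint x y := by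
  by_cases h : 1 < x ∧ 2 ≤ y
  · exact (saddlePoint_pos h.1 h.2).le
  · rw [saddlePoint, dif_neg h]

/-- **Class-restricted smooth-weighted friable exponential sums on a major arc.** Let `B ∈ ℕ`,
`ε, ε₀, C_F > 0`. Assume (hW) the saddle-point evaluation `S_w(λ; x/e') = e'^{−α}𝓜Ŵ_λ(α) +
O(e'^{−α} ε' 𝓜/(1+|λ|))` uniformly for `e' ≤ (log x)^{B'}` (every `B'`, `ε' > 0`, `x ≥ x₀(B', ε')`), and
(hF) `‖∑_{n ∈ S(X,y)} χ(n) W_λ(n/X)‖ ≤ C_F (1+|λ|)³ X^{1/2+ε₀} q^{ε₀}` for `X ≥ 1`, `χ ≠ χ₀ (mod q)`.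
Then there is `x₀` such that for `x ≥ x₀`, `(log x)^4 ≤ y`, `log y ≤ (log x)^{1/5}`, `1 ≤ Λ`, `Λ⁸ ≤ y`,
`1 ≤ e ≤ (log x)^B`, `y`-friable `1 ≤ m, k ≤ (log x)^B`, `(r, m) = 1`, `h ∈ ℤ`, `|λ| ≤ Λ`
(`L = lcm(k, m)`, `α = α(x,y)`, `𝓜 = x^α ζ(α,y)/√(2πφ₂(α,y))`):
`‖classArcSum (x/e) y m r k h λ − classLocalFactor α m r k h · e^{−α}𝓜 Ŵ_λ(α)‖`
`≤ e^{−α} (ε𝓜/(1+|λ|)) classLocalH α m r k + L · C_F (1+|λ|)³ (x/e)^{1/2+ε₀} L^{ε₀}`.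
[cite: Harper2016, §2.2 (Major Arc Estimate 2) and §5] -/
theorem classArcSum_estimate (B : ℕ) {ε ε₀ C_F : ℝ} (hε : 0 < ε) (hε₀ : 0 < ε₀) (hC : 0 < C_F)
    (hW : ∀ (B' : ℕ) (ε' : ℝ), 0 < ε' → ∃ x₀ : ℝ, ∀ (x : ℝ) (y : ℕ), x₀ ≤ x → Real.log x ^ 4 ≤ (y : ℝ) →
      Real.log (y : ℝ) ≤ Real.log x ^ (1 / 5 : ℝ) →
      ∀ Λ : ℝ, 1 ≤ Λ → Λ ^ 8 ≤ (y : ℝ) → ∀ e : ℕ, 1 ≤ e → (e : ℝ) ≤ Real.log x ^ B' → ∀ lam : ℝ, |lam| ≤ Λ →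
      ‖(∑ n ∈ Nat.smoothNumbersUpTo ⌊x / e⌋₊ (y + 1), twistWeight lam (n / (x / e))) -
          ((((e : ℝ) ^ (-saddlePoint x y) * (x ^ saddlePoint x y * smoothZeta (saddlePoint x y) y /
              Real.sqrt (2 * Real.pi * saddlePhi₂ (saddlePoint x y) y)) : ℝ)) : ℂ) * twistMellin lam (saddlePoint x y)‖ ≤
        (e : ℝ) ^ (-saddlePoint x y) * (ε' * (x ^ saddlePoint x y * smoothZeta (saddlePoint x y) y /
          Real.sqrt (2 * Real.pi * saddlePhi₂ (saddlePoint x y) y)) / (1 + |lam|)))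
    (hF : ∀ (q : ℕ) (χ : DirichletCharacter ℂ q), q ≠ 0 → χ ≠ 1 → ∀ (y : ℕ) (X lam : ℝ), 1 ≤ X →
      ‖∑ n ∈ Nat.smoothNumbersUpTo ⌊X⌋₊ (y + 1), χ (n : ZMod q) * twistWeight lam (n / X)‖ ≤
        C_F * (1 + |lam|) ^ 3 * X ^ (1 / 2 + ε₀) * (q : ℝ) ^ ε₀) :
    ∃ x₀ : ℝ, ∀ (x : ℝ) (y : ℕ), x₀ ≤ x → Real.log x ^ 4 ≤ (y : ℝ) → Real.log (y : ℝ) ≤ Real.log x ^ (1 / 5 : ℝ) →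
      ∀ Λ : ℝ, 1 ≤ Λ → Λ ^ 8 ≤ (y : ℝ) →
      ∀ e : ℕ, 1 ≤ e → (e : ℝ) ≤ Real.log x ^ B →
      ∀ m : ℕ, 1 ≤ m → (m : ℝ) ≤ Real.log x ^ B → m ∈ Nat.smoothNumbers (y + 1) →
      ∀ r : ℕ, Nat.Coprime r m →
      ∀ k : ℕ, 1 ≤ k → (k : ℝ) ≤ Real.log x ^ B → k ∈ Nat.smoothNumbers (y + 1) →
      ∀ (h : ℤ) (lam : ℝ), |lam| ≤ Λ →
      ‖classArcSum (x / e) y m r k h lam -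
          classLocalFactor (saddlePoint x y) m r k h *
            (((((e : ℝ) ^ (-saddlePoint x y) * (x ^ saddlePoint x y * smoothZeta (saddlePoint x y) y /
                Real.sqrt (2 * Real.pi * saddlePhi₂ (saddlePoint x y) y)) : ℝ)) : ℂ) * twistMellin lam (saddlePoint x y))‖ ≤
        (e : ℝ) ^ (-saddlePoint x y) * (ε * (x ^ saddlePoint x y * smoothZeta (saddlePoint x y) y /
            Real.sqrt (2 * Real.pi * saddlePhi₂ (saddlePoint x y) y)) / (1 + |lam|)) * classLocalH (saddlePoint x y) m r k +
        (Nat.lcm k m : ℝ) * (C_F * (1 + |lam|) ^ 3 * (x / e) ^ (1 / 2 + ε₀) * ((Nat.lcm k m : ℕ) : ℝ) ^ ε₀) := by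
  obtain ⟨x₀, hmain⟩ := hW (3 * B) ε hε
  refine ⟨max x₀ 1, fun x y hx hy4 hylog Λ hΛ1 hΛy e he heB m hm hmB hmS r _hr k hk hkB hkS h lam hlam => ?_⟩
  have hx₀ : x₀ ≤ x := le_trans (le_max_left _ _) hx
  have hx0 : 0 ≤ x := le_trans zero_le_one (le_trans (le_max_right _ _) hx)
  have he0 : (0 : ℝ) < e := by exact_mod_cast he
  have hX0 : 0 ≤ x / e := by positivity
  have hm0 : m ≠ 0 := by omega
  have hk0 : k ≠ 0 := by omega
  rw [classArcSum_eq_sum_mod (x / e) y hm0 hk0 r h lam]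
  unfold classLocalFactor classLocalH
  set α : ℝ := saddlePoint x y with hα
  have hα0 : 0 ≤ α := saddlePoint_nonneg x y
  set L : ℕ := Nat.lcm k m with hL
  set T : Finset ℕ := (Finset.range L).filter (fun t => t ≡ r [MOD m]) with hT
  set M₀ : ℝ := x ^ α * smoothZeta α y / Real.sqrt (2 * Real.pi * saddlePhi₂ α y) with hM₀
  set A : ℝ := (e : ℝ) ^ (-α) * M₀ with hA
  set E : ℝ := (e : ℝ) ^ (-α) * (ε * M₀ / (1 + |lam|)) with hE
  set Bd : ℝ := C_F * (1 + |lam|) ^ 3 * (x / e) ^ (1 / 2 + ε₀) * (L : ℝ) ^ ε₀ with hBd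
  set Ŵ : ℂ := twistMellin lam α with hŴ
  have hLpos : 0 < L := Nat.lcm_pos (by omega) (by omega)
  have hL0 : L ≠ 0 := hLpos.ne'
  have hLS : L ∈ Nat.smoothNumbers (y + 1) :=
    Nat.mem_smoothNumbers_of_dvd (Nat.mul_mem_smoothNumbers hkS hmS) (Nat.lcm_dvd_mul k m)
  have hBd0 : 0 ≤ Bd := by positivity
  -- `e L ≤ (log x)^{3B}`
  have heL : (e : ℝ) * L ≤ Real.log x ^ (3 * B) := by
    have hLkm : (L : ℝ) ≤ (k : ℝ) * m := by exact_mod_cast Nat.lcm_le_mul (by omega) (by omega)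
    have hkm : (k : ℝ) * m ≤ Real.log x ^ B * Real.log x ^ B :=
      mul_le_mul hkB hmB (Nat.cast_nonneg m) ((Nat.cast_nonneg k).trans hkB)
    calc (e : ℝ) * L ≤ Real.log x ^ B * (Real.log x ^ B * Real.log x ^ B) :=
          mul_le_mul heB (hLkm.trans hkm) (Nat.cast_nonneg L) ((Nat.cast_nonneg e).trans heB)
      _ = Real.log x ^ (3 * B) := by rw [← pow_add, ← pow_add]; ring_nf
  -- (hW) at the scales `x/(e e')`, `e' ∣ L`
  have hS : ∀ e' : ℕ, e' ∣ L →
      ‖smoothTwistSum (x / e / e') y lam - ((((e' : ℕ) : ℝ) ^ (-α) * A : ℝ) : ℂ) * Ŵ‖ ≤ (e' : ℝ) ^ (-α) * E := by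
    intro e' he'
    have he'1 : 1 ≤ e' := Nat.pos_of_dvd_of_pos he' hLpos
    have he'0 : (0 : ℝ) ≤ e' := Nat.cast_nonneg e'
    have he1 : 1 ≤ e * e' := Nat.one_le_iff_ne_zero.mpr (mul_ne_zero (by omega) (by omega))
    have heL' : ((e * e' : ℕ) : ℝ) ≤ Real.log x ^ (3 * B) := by
      push_cast
      refine le_trans (mul_le_mul_of_nonneg_left ?_ (Nat.cast_nonneg e)) heL
      exact_mod_cast Nat.le_of_dvd hLpos he'
    have hW1 := hmain x y hx₀ hy4 hylog Λ hΛ1 hΛy (e * e') he1 heL' lam hlam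
    rw [← hα] at hW1
    have hsc : x / e / e' = x / ((e * e' : ℕ) : ℝ) := by push_cast; rw [div_div]
    have hconst : ((e * e' : ℕ) : ℝ) ^ (-α) * M₀ = (e' : ℝ) ^ (-α) * A := by
      rw [hA]; push_cast
      rw [Real.mul_rpow he0.le he'0]; ring
    have hconst' : ((e * e' : ℕ) : ℝ) ^ (-α) * (ε * M₀ / (1 + |lam|)) = (e' : ℝ) ^ (-α) * E := by
      rw [hE]; push_cast
      rw [Real.mul_rpow he0.le he'0]; ring
    rw [hsc, ← hconst, ← hconst']
    simpa [smoothTwistSum, hM₀] using hW1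
  -- (hF) on the sub-scales
  have hF' : ∀ (g' L'' : ℕ) [NeZero L''], 0 < g' → L'' ≤ L → ∀ ψ : DirichletCharacter ℂ L'', ψ ≠ 1 →
      ‖∑ n ∈ Nat.smoothNumbersUpTo ⌊x / e / g'⌋₊ (y + 1), ψ (n : ZMod L'') * twistWeight lam (n / (x / e / g'))‖ ≤ Bd :=
    fun g' L'' _ hg' hL''L ψ hψ => charSum_bound_subscale hC hε₀ hF hX0 hg' (NeZero.ne L'') hL''L y lam ψ hψ
  -- the main term as a sum over `t ∈ T` with the same phases
  have hfac : (∑ t ∈ T, (𝐞 ((h * t : ℝ) / k) : ℂ) *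
      ((((Nat.gcd t L : ℕ) : ℝ) ^ (-α) * (∏ p ∈ (L / Nat.gcd t L).primeFactors, (1 - (p : ℝ) ^ (-α))) /
        ((L / Nat.gcd t L).totient : ℝ) : ℝ) : ℂ)) * (((A : ℝ) : ℂ) * Ŵ) =
      ∑ t ∈ T, (𝐞 ((h * t : ℝ) / k) : ℂ) *
        (((((Nat.gcd t L : ℕ) : ℝ) ^ (-α) * (∏ p ∈ (L / Nat.gcd t L).primeFactors, (1 - (p : ℝ) ^ (-α))) /
          ((L / Nat.gcd t L).totient : ℝ) * A : ℝ) : ℂ) * Ŵ) := by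
    rw [Finset.sum_mul]
    refine Finset.sum_congr rfl fun t _ => ?_
    push_cast; ring
  rw [hfac, ← Finset.sum_sub_distrib]
  -- per-class bound
  have hterm : ∀ t ∈ T,
      ‖(𝐞 ((h * t : ℝ) / k) : ℂ) * (∑ n ∈ (Nat.smoothNumbersUpTo ⌊x / e⌋₊ (y + 1)).filter (fun n => n % L = t),
          twistWeight lam (n / (x / e))) -
        (𝐞 ((h * t : ℝ) / k) : ℂ) *
          (((((Nat.gcd t L : ℕ) : ℝ) ^ (-α) * (∏ p ∈ (L / Nat.gcd t L).primeFactors, (1 - (p : ℝ) ^ (-α))) /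
            ((L / Nat.gcd t L).totient : ℝ) * A : ℝ) : ℂ) * Ŵ)‖ ≤
        ((Nat.gcd t L : ℕ) : ℝ) ^ (-α) * ((L / Nat.gcd t L).divisors.card : ℝ) / ((L / Nat.gcd t L).totient : ℝ) * E +
          Bd := by
    intro t ht
    have htL : t < L := Finset.mem_range.mp (Finset.mem_filter.mp ht).1
    rw [← mul_sub, norm_mul, Circle.norm_coe, one_mul]
    exact fiber_estimate hX0 hL0 htL hLS hα0 A E Ŵ lam hBd0 hS hF'
  have hcard : (T.card : ℝ) ≤ L := by
    exact_mod_cast (Finset.card_filter_le _ _).trans (Finset.card_range L).le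
  calc ‖∑ t ∈ T, ((𝐞 ((h * t : ℝ) / k) : ℂ) *
          (∑ n ∈ (Nat.smoothNumbersUpTo ⌊x / e⌋₊ (y + 1)).filter (fun n => n % L = t), twistWeight lam (n / (x / e))) -
        (𝐞 ((h * t : ℝ) / k) : ℂ) *
          (((((Nat.gcd t L : ℕ) : ℝ) ^ (-α) * (∏ p ∈ (L / Nat.gcd t L).primeFactors, (1 - (p : ℝ) ^ (-α))) /
            ((L / Nat.gcd t L).totient : ℝ) * A : ℝ) : ℂ) * Ŵ))‖
      ≤ ∑ t ∈ T, (((Nat.gcd t L : ℕ) : ℝ) ^ (-α) * ((L / Nat.gcd t L).divisors.card : ℝ) /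
          ((L / Nat.gcd t L).totient : ℝ) * E + Bd) := (norm_sum_le _ _).trans (Finset.sum_le_sum hterm)
    _ = (∑ t ∈ T, ((Nat.gcd t L : ℕ) : ℝ) ^ (-α) * ((L / Nat.gcd t L).divisors.card : ℝ) /
          ((L / Nat.gcd t L).totient : ℝ)) * E + (T.card : ℝ) * Bd := by
        rw [Finset.sum_add_distrib, Finset.sum_mul, Finset.sum_const, nsmul_eq_mul]
    _ ≤ (∑ t ∈ T, ((Nat.gcd t L : ℕ) : ℝ) ^ (-α) * ((L / Nat.gcd t L).divisors.card : ℝ) /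
          ((L / Nat.gcd t L).totient : ℝ)) * E + (L : ℝ) * Bd := by
        gcongr
    _ = E * (∑ t ∈ T, ((Nat.gcd t L : ℕ) : ℝ) ^ (-α) * ((L / Nat.gcd t L).divisors.card : ℝ) /
          ((L / Nat.gcd t L).totient : ℝ)) + (L : ℝ) * Bd := by ring

end SmoothArcs

end Literature.NumberTheory.Sieve

end
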